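import Literature.AnabelianGeometry.EtaleTheta.ThetaSubquotientOfTemperedAutImage
import Literature.AnabelianGeometry.EtaleTheta.Discharge.Sec5ThetaSubquotientLevelNOfConnectedTemperoid
import Literature.AnabelianGeometry.EtaleTheta.Discharge.Sec4BaseEquivOfTemperoids

/-!
# [EtTh] §5 over `B^temp(Π^tp_X)⁰`: `B_N^bs` is a Galois object; print's `Aut`-projection is ONTO there (the v-next clause at the object the chain uses)

Mochizuki, *The étale theta function and its Frobenioid-theoretic manifestations*, Publ. RIMS **45** (2009), §5 p. 330–331 (PDF
pp. 104–105) (`A_N`, `B_N` and the base-equivalent pair `s^⊓_N, s^⊔_N : A_N → B_N`), p. 327 (PDF p. 101) ("`(l·Δ_Θ)_D ⊆ Aut^Θ_D(D)`").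
[cite: MochizukiEtTh2009, §5 p.327–331 (PDF pp.101–105)]

PROOF-ONLY (no definitions).  abc-iut cell, seat abc-iut-w5-d020 (gen 4) — closing the R181 / G-w4d042g3-1 line with the two facts
abc-iut-w4-d042 recorded as compiling in his handed-over draft (09:04:03Z, findings (1)(2)), stated over the GENERAL connected setting
`BiKummerSetting.mkOfConnectedTemperoid X tf hZ hP NH A₀ hA₀ hA₀'` of abc-iut-L2-t4 and an `N`-th root `R` over it:

* `isGaloisObj_base_BN` — **`B_N^bs` is a Galois object of `B^temp(Π^tp_X)`**: it is isomorphic (the root's base isomorphism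
  `NthRoot.baseIso : A_N^bs ≅ B_N^bs`, read on underlying `Π`-sets) to the Galois object `A_N^bs` (`R.αData.isGalois`), and Galois-ness
  is iso-invariant (abc-iut-L2-t1 lineage `GaloisObjects.isGaloisObj_of_iso`);
* `autProj_surjective_base_BN_levelN` — hence **print's `Aut`-projection `autPre ↠ (l·Δ_Θ)_{B_N^bs}` for abc-iut-L2-t9's R2 carrier at
  the level-`N` parameters `(q_N, ι_N)` is ONTO at `B_N^bs`** — i.e. abc-iut-L2-t4's planned v-next clause
  `proj_surjective_of_isGaloisObj` (GAP-LEDGER G-w4d042g3-1, plan (a)) INSTANTIATED at the one object where the Prop 5.5 / Thm 5.6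
  chain evaluates `P` (abc-iut-w4-d042's `autProj_surjective_of_isGaloisObj` + `RigidData.qN_surjective`);
* `autImage_base_BN_eq_top_levelN` — equivalently print's image carrier (`autImage`, p432202) at `B_N^bs` is the WHOLE R2 carrier: at
  `B_N^bs` the two carriers of the DUAL CLAUSE coincide.

Nothing of [EtTh]'s curves is asserted; no side taken on [IUTchIII] Cor. 3.12.
-/

noncomputable section

namespace Literature.AnabelianGeometry.EtaleTheta

namespace ThetaFrobenioid

open CategoryTheory Opposite Literature.AlgebraicGeometry.Frobenioids Literature.AnabelianGeometry.SemiGraphs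
  Literature.AnabelianGeometry.SemiGraphs.GaloisObjects

universe u₀ v₀ w

variable {K : Type u₀} [Field K] {X : SemiGraphs.TemperedArithmeticGroup.{u₀} K} {D₀ : Type u₀} [Category.{v₀} D₀]
  {V : FrdIMonoidStub.{w}} {T₀ : RealifiedDivisorMonoids (D₀ := D₀) V}
  {VD : FrdICatStub.{u₀ + 1, u₀, w} (ConnectedPart (BTemp X.Pi))}
  {tf : TemperedFrobenioid T₀ (ConnectedPart (BTemp X.Pi)) VD} {hZ : tf.monoidType = MonoidType.Z}
  {hP : ∀ A : (ConnectedPart (BTemp X.Pi))ᵒᵖ, IsPerfect (tf.Φ.carrier A)}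
  {NH : Subgroup (Field.absoluteGaloisGroup K) → tf.category → ℕ+ → Prop} {A₀ : tf.category}
  {hA₀ : PreFrobenioid.IsFrobeniusTrivial tf.toElem A₀} {hA₀' : SemiGraphs.IsGaloisObj A₀.base.obj}
  {pullFrac : ∀ {A A' : (BiKummerSetting.mkOfConnectedTemperoid X tf hZ hP NH A₀ hA₀ hA₀').C} (_ : A' ⟶ A),
    (BiKummerSetting.mkOfConnectedTemperoid X tf hZ hP NH A₀ hA₀ hA₀').biratUnits A →
      (BiKummerSetting.mkOfConnectedTemperoid X tf hZ hP NH A₀ hA₀ hA₀').biratUnits A'}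
  {lv : ℕ+}
  {θ : (BiKummerSetting.mkOfConnectedTemperoid X tf hZ hP NH A₀ hA₀ hA₀').biratUnits
    (BiKummerSetting.mkOfConnectedTemperoid X tf hZ hP NH A₀ hA₀ hA₀').Aodot}
  {Bl : (BiKummerSetting.mkOfConnectedTemperoid X tf hZ hP NH A₀ hA₀ hA₀').C}
  {Pl : (BiKummerSetting.mkOfConnectedTemperoid X tf hZ hP NH A₀ hA₀ hA₀').FractionPair θ Bl}
  {Rl : (BiKummerSetting.mkOfConnectedTemperoid X tf hZ hP NH A₀ hA₀ hA₀').NthRoot θ Pl lv pullFrac}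
  {N : ℕ+} (R : (BiKummerSetting.mkOfConnectedTemperoid X tf hZ hP NH A₀ hA₀ hA₀').NthRoot Rl.root Rl.pair N pullFrac)

/-- **`B_N^bs` is a Galois object of `B^temp(Π^tp_X)`**: isomorphic to the Galois object `A_N^bs` by the root's base isomorphism.
[cite: MochizukiEtTh2009, §5 p.330–331 (PDF pp.104–105)] -/
theorem isGaloisObj_base_BN : IsGaloisObj R.BN.base.obj :=
  isGaloisObj_of_iso X.isTempered ((connectedObjects (BTemp X.Pi)).ι.mapIso (BiKummerSetting.NthRoot.baseIso _ R)).symm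
    R.αData.isGalois

variable {l' : ℕ} {RD : RigidData.{max u₀ w} N l'} (ιX : RD.PiX ≃ₜ* X.Pi)

/-- **Print's `Aut`-projection `autPre ↠ (l·Δ_Θ)_{B_N^bs}` is ONTO at `B_N^bs`** for abc-iut-L2-t9's R2 carrier at the level-`N` parameters
`(q_N, ι_N)` — the v-next clause «onto at Galois objects» (GAP-LEDGER G-w4d042g3-1, plan (a)) at the object where the chain evaluates `P`.
[cite: MochizukiEtTh2009, §5 p.327 (PDF p.101)] -/
theorem autProj_surjective_base_BN_levelN [RD.iotaN.range.Normal] :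
    Function.Surjective (ThetaSubquotient.autProj (RD.qN ιX) RD.iotaN R.BN.base.obj) :=
  ThetaSubquotient.autProj_surjective_of_isGaloisObj (RD.qN ιX) RD.iotaN X.isTempered _ (isGaloisObj_base_BN R)
    (RD.qN_surjective ιX)

/-- **At `B_N^bs` print's image carrier is the whole R2 carrier** (the two carriers of the DUAL CLAUSE coincide where the chain reads them).
[cite: MochizukiEtTh2009, §5 p.327 (PDF p.101)] -/
theorem autImage_base_BN_eq_top_levelN [RD.iotaN.range.Normal] :
    ThetaSubquotient.autImage (RD.qN ιX) RD.iotaN R.BN.base.obj = ⊤ :=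
  ThetaSubquotient.autImage_eq_top_of_isGaloisObj (RD.qN ιX) RD.iotaN X.isTempered _ (isGaloisObj_base_BN R)
    (RD.qN_surjective ιX)

end ThetaFrobenioid

end Literature.AnabelianGeometry.EtaleTheta

end
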